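import Summits.Ventures.PercRepro.Defs
import Summits.Ventures.PercRepro.Conditioning

/-!
# Single-flip concavity: a second-moment inequality for product Bernoulli laws

Let `ω, ω'` be two independent configurations with the product Bernoulli law `P_p`, and let
`B : Config E → Config E → ℝ`.  The second moment `expect2 p p B = E[B(ω, ω')]` is, for each
edge `e`, a polynomial of degree `≤ 2` in `p e`.  Its `p e ^ 2`-coefficient is
`E[ Δ_e B ]`, where `Δ_e B (ω, ω') = B(ω¹,ω'¹) - B(ω¹,ω'⁰) - B(ω⁰,ω'¹) + B(ω⁰,ω'⁰)` is the
mixed second difference along the edge `e` (`ω¹ = ω[e := true]`, `ω⁰ = ω[e := false]`).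

**Theorem (`expect2_nonneg_of_flipConcave`).**  If `B(ω, ω) ≥ 0` for every `ω` and
`Δ_e B ≤ 0` pointwise for every edge `e`, then `E[B(ω, ω')] ≥ 0` for every `p ∈ [0,1]^E`.

Proof: `E[B]` is concave in each `p e` separately (the leading coefficient is `≤ 0`), hence lies
above its chord between `p e = 0` and `p e = 1`; induction on the number of non-deterministic
edges reduces to the point masses, where `E[B] = B(ω, ω) ≥ 0`.  This is exactly the structure
of the classical edge-induction proof of the Harris inequality, made into a reusable principle.

**Corollary (`smc_xval`, single-merge concavity; cross-validation twin of p4's `smc_principle`).**  For a statistic `Φ : Config E → S` which, when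
one edge is opened, either stays fixed or moves along a relation `R` (for the partition of a
set of marked vertices: a merge of two blocks), every quadratic form `A : S → S → ℝ` with
`A s s ≥ 0` and `A t t' - A t s' - A s t' + A s s' ≤ 0` for all `R`-steps `(s,t)`, `(s',t')`
satisfies `Σ_{s,t} A s t · P(Φ = s) · P(Φ = t) ≥ 0`.

Only the splitting identity `weight_split` and the edge-flip involution `flipEdge` of
`Summits.Ventures.PercRepro.Conditioning` are used; no FKG / BK input.
-/

namespace PercRepro

open Finset

variable {E : Type*} [Fintype E] [DecidableEq E]

/-! ### The second-moment functional -/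

/-- `expect2 p q B = Σ_ω w_p(ω) Σ_ω' w_q(ω') B ω ω'`: the expectation of `B ω ω'` for
independent configurations `ω ~ P_p` and `ω' ~ P_q`. -/
def expect2 (p q : E → ℝ) (B : Config E → Config E → ℝ) : ℝ :=
  ∑ ω, weight p ω * ∑ ω', weight q ω' * B ω ω'

/-- Linearity: `expect2` of a sum. -/
theorem expect2_add (p q : E → ℝ) (B C : Config E → Config E → ℝ) :
    expect2 p q (fun ω ω' => B ω ω' + C ω ω') = expect2 p q B + expect2 p q C := by
  unfold expect2
  rw [← Finset.sum_add_distrib]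
  refine Finset.sum_congr rfl fun ω _ => ?_
  rw [← mul_add, ← Finset.sum_add_distrib]
  congr 1
  refine Finset.sum_congr rfl fun ω' _ => ?_
  ring

/-- Linearity: `expect2` of a difference. -/
theorem expect2_sub (p q : E → ℝ) (B C : Config E → Config E → ℝ) :
    expect2 p q (fun ω ω' => B ω ω' - C ω ω') = expect2 p q B - expect2 p q C := by
  unfold expect2
  rw [← Finset.sum_sub_distrib]
  refine Finset.sum_congr rfl fun ω _ => ?_
  rw [← mul_sub, ← Finset.sum_sub_distrib]
  congr 1
  refine Finset.sum_congr rfl fun ω' _ => ?_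
  ring

/-- Linearity: `expect2` of a scalar multiple. -/
theorem expect2_const_mul (p q : E → ℝ) (c : ℝ) (B : Config E → Config E → ℝ) :
    expect2 p q (fun ω ω' => c * B ω ω') = c * expect2 p q B := by
  unfold expect2
  simp only [Finset.mul_sum]
  refine Finset.sum_congr rfl fun ω _ => Finset.sum_congr rfl fun ω' _ => ?_
  ring

/-- Independence: `expect2` of a product `f ω * g ω'` is the product of the expectations. -/
theorem expect2_mul (p q : E → ℝ) (f g : Config E → ℝ) :
    expect2 p q (fun ω ω' => f ω * g ω') = expect p f * expect q g := by
  unfold expect2 expect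
  rw [Finset.sum_mul]
  refine Finset.sum_congr rfl fun ω _ => ?_
  rw [Finset.mul_sum, Finset.mul_sum]
  refine Finset.sum_congr rfl fun ω' _ => ?_
  ring

/-! ### Conditioning each copy on one edge -/

/-- Conditioning the first copy on the edge `e`. -/
theorem expect2_split_left (p q : E → ℝ) (e : E) (B : Config E → Config E → ℝ) :
    expect2 p q B = p e * expect2 (Function.update p e 1) q B
      + (1 - p e) * expect2 (Function.update p e 0) q B := by
  unfold expect2
  rw [Finset.mul_sum, Finset.mul_sum, ← Finset.sum_add_distrib]
  refine Finset.sum_congr rfl fun ω _ => ?_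
  rw [weight_split p e ω]
  ring

/-- Conditioning the second copy on the edge `e`. -/
theorem expect2_split_right (p q : E → ℝ) (e : E) (B : Config E → Config E → ℝ) :
    expect2 p q B = q e * expect2 p (Function.update q e 1) B
      + (1 - q e) * expect2 p (Function.update q e 0) B := by
  unfold expect2
  have inner : ∀ ω, ∑ ω', weight q ω' * B ω ω'
      = q e * ∑ ω', weight (Function.update q e 1) ω' * B ω ω'
        + (1 - q e) * ∑ ω', weight (Function.update q e 0) ω' * B ω ω' := by
    intro ω
    rw [Finset.mul_sum, Finset.mul_sum, ← Finset.sum_add_distrib]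
    refine Finset.sum_congr rfl fun ω' _ => ?_
    rw [weight_split q e ω']
    ring
  simp_rw [inner]
  rw [Finset.mul_sum, Finset.mul_sum, ← Finset.sum_add_distrib]
  refine Finset.sum_congr rfl fun ω _ => ?_
  ring

/-- **Chord identity**: `E_p[B]` minus the chord value `p_e E_{p[e:=1]}[B] + (1 - p_e) E_{p[e:=0]}[B]`
equals `p_e (1 - p_e)` times the (negated) mixed second difference of the four conditioned
second moments. -/
theorem expect2_chord (p : E → ℝ) (e : E) (B : Config E → Config E → ℝ) :
    expect2 p p B =
      p e * expect2 (Function.update p e 1) (Function.update p e 1) B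
        + (1 - p e) * expect2 (Function.update p e 0) (Function.update p e 0) B
        + p e * (1 - p e) *
          (expect2 (Function.update p e 1) (Function.update p e 0) B
            + expect2 (Function.update p e 0) (Function.update p e 1) B
            - expect2 (Function.update p e 1) (Function.update p e 1) B
            - expect2 (Function.update p e 0) (Function.update p e 0) B) := by
  rw [expect2_split_left p p e B, expect2_split_right (Function.update p e 1) p e B,
    expect2_split_right (Function.update p e 0) p e B]
  ring

/-! ### Re-indexing the conditioned sums through the edge flip -/

/-- Under `p[e := 0]` a summand may be evaluated at `ω[e := false]`. -/
theorem sum_weight_update_zero_mul (p : E → ℝ) (e : E) (g : Config E → ℝ) :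
    ∑ ω, weight (Function.update p e 0) ω * g ω
      = ∑ ω, weight (Function.update p e 0) ω * g (Function.update ω e false) := by
  refine Finset.sum_congr rfl fun ω _ => ?_
  rw [weight_update_zero]
  cases h : ω e
  · simp only [Bool.false_eq_true, ↓reduceIte]
    rw [Function.update_eq_self_iff.2 h.symm]
  · simp

/-- The weight of the flipped configuration under `p[e := 1]` is the weight of the original
configuration under `p[e := 0]`. -/
theorem weight_update_one_flipEdge (p : E → ℝ) (e : E) (ω : Config E) :
    weight (Function.update p e 1) (flipEdge e ω) = weight (Function.update p e 0) ω := by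
  rw [weight_update_one, weight_update_zero, flipEdge_apply_self, weightErase_flipEdge]
  cases ω e <;> simp

omit [Fintype E] in
/-- Opening `e` after flipping it is the same as opening it. -/
theorem update_flipEdge_true (e : E) (ω : Config E) :
    Function.update (flipEdge e ω) e true = Function.update ω e true := by
  simp [flipEdge, Function.update_idem]

/-- Under `p[e := 1]` a summand may be evaluated at `ω[e := true]`, and the weight may then be
replaced by the weight under `p[e := 0]` (the edge flip is a weight-preserving bijection between
`{e open}` and `{e closed}`). -/
theorem sum_weight_update_one_mul (p : E → ℝ) (e : E) (g : Config E → ℝ) :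
    ∑ ω, weight (Function.update p e 1) ω * g ω
      = ∑ ω, weight (Function.update p e 0) ω * g (Function.update ω e true) := by
  have h1 : ∑ ω, weight (Function.update p e 1) ω * g ω
      = ∑ ω, weight (Function.update p e 1) ω * g (Function.update ω e true) := by
    refine Finset.sum_congr rfl fun ω _ => ?_
    rw [weight_update_one]
    cases h : ω e
    · simp
    · simp only [↓reduceIte]
      rw [Function.update_eq_self_iff.2 h.symm]
  rw [h1, ← (flipEdge_involutive e).bijective.sum_comp]
  refine Finset.sum_congr rfl fun ω _ => ?_
  rw [weight_update_one_flipEdge, update_flipEdge_true]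

/-- Both cases at once, indexed by the prescribed state `b` of the edge. -/
theorem sum_weight_update_mul (p : E → ℝ) (e : E) (b : Bool) (g : Config E → ℝ) :
    ∑ ω, weight (Function.update p e (if b then 1 else 0)) ω * g ω
      = ∑ ω, weight (Function.update p e 0) ω * g (Function.update ω e b) := by
  cases b
  · simp only [Bool.false_eq_true, ↓reduceIte]
    exact sum_weight_update_zero_mul p e g
  · simp only [↓reduceIte]
    exact sum_weight_update_one_mul p e g

/-- The four conditioned second moments, all expressed with the weight `p[e := 0]` on both
copies and the prescribed states substituted into `B`. -/
theorem expect2_update (p : E → ℝ) (e : E) (B : Config E → Config E → ℝ) (a b : Bool) :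
    expect2 (Function.update p e (if a then 1 else 0)) (Function.update p e (if b then 1 else 0)) B
      = ∑ ω, weight (Function.update p e 0) ω *
          ∑ ω', weight (Function.update p e 0) ω' *
            B (Function.update ω e a) (Function.update ω' e b) := by
  unfold expect2
  rw [sum_weight_update_mul p e a]
  refine Finset.sum_congr rfl fun ω _ => ?_
  congr 1
  exact sum_weight_update_mul p e b (fun ω' => B (Function.update ω e a) ω')

/-- **Concavity along one edge**: if the mixed second difference of `B` along `e` is
pointwise `≤ 0`, the bracket of the chord identity is `≥ 0`. -/
theorem expect2_bracket_nonneg {p : E → ℝ} (hp : IsProb p) (e : E)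
    {B : Config E → Config E → ℝ}
    (hB : ∀ ω ω', B (Function.update ω e true) (Function.update ω' e true)
        - B (Function.update ω e true) (Function.update ω' e false)
        - B (Function.update ω e false) (Function.update ω' e true)
        + B (Function.update ω e false) (Function.update ω' e false) ≤ 0) :
    0 ≤ expect2 (Function.update p e 1) (Function.update p e 0) B
        + expect2 (Function.update p e 0) (Function.update p e 1) B
        - expect2 (Function.update p e 1) (Function.update p e 1) B
        - expect2 (Function.update p e 0) (Function.update p e 0) B := by
  have h11 := expect2_update p e B true true
  have h10 := expect2_update p e B true false
  have h01 := expect2_update p e B false true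
  have h00 := expect2_update p e B false false
  simp only [Bool.false_eq_true, ↓reduceIte] at h11 h10 h01 h00
  rw [h11, h10, h01, h00, ← Finset.sum_add_distrib, ← Finset.sum_sub_distrib,
    ← Finset.sum_sub_distrib]
  have hp0 : IsProb (Function.update p e 0) := hp.update e ⟨le_rfl, zero_le_one⟩
  refine Finset.sum_nonneg fun ω _ => ?_
  rw [← mul_add, ← mul_sub, ← mul_sub]
  refine mul_nonneg (weight_nonneg hp0 ω) ?_
  rw [← Finset.sum_add_distrib, ← Finset.sum_sub_distrib, ← Finset.sum_sub_distrib]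
  refine Finset.sum_nonneg fun ω' _ => ?_
  rw [← mul_add, ← mul_sub, ← mul_sub]
  refine mul_nonneg (weight_nonneg hp0 ω') ?_
  linarith [hB ω ω']

/-! ### Deterministic weight vectors -/

/-- The configuration selected by a deterministic weight vector (`p e ∈ {0, 1}` for all `e`):
the edge `e` is open iff `p e = 1`. -/
noncomputable def detConfig (p : E → ℝ) : Config E := fun e => decide (p e = 1)

omit [DecidableEq E] in
/-- A deterministic weight vector is the point mass at `detConfig p`. -/
theorem weight_det {p : E → ℝ} (hp : ∀ e, p e = 0 ∨ p e = 1) (ω : Config E) :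
    weight p ω = if ω = detConfig p then 1 else 0 := by
  unfold weight
  split_ifs with h
  · subst h
    refine Finset.prod_eq_one fun e _ => ?_
    rcases hp e with h0 | h1
    · simp [detConfig, h0]
    · simp [detConfig, h1]
  · obtain ⟨e, he⟩ : ∃ e, ω e ≠ detConfig p e := by
      by_contra hcon
      exact h (funext fun e => by
        by_contra he
        exact hcon ⟨e, he⟩)
    refine Finset.prod_eq_zero (Finset.mem_univ e) ?_
    rcases hp e with h0 | h1
    · have : ω e = true := by
        simp only [detConfig, h0, zero_ne_one, decide_false] at he
        cases hb : ω e
        · exact absurd hb he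
        · rfl
      simp [this, h0]
    · have : ω e = false := by
        simp only [detConfig, h1, decide_true] at he
        cases hb : ω e
        · rfl
        · exact absurd hb he
      simp [this, h1]

/-- Under a deterministic weight vector the second moment is the diagonal value at the selected
configuration. -/
theorem expect2_det {p : E → ℝ} (hp : ∀ e, p e = 0 ∨ p e = 1)
    (B : Config E → Config E → ℝ) :
    expect2 p p B = B (detConfig p) (detConfig p) := by
  unfold expect2
  simp only [weight_det hp, ite_mul, one_mul, zero_mul, Finset.sum_ite_eq', Finset.mem_univ,
    if_true]

/-! ### The main theorem -/

/-- **Single-flip concavity.**  If `B ω ω ≥ 0` for all `ω` and, for every edge `e`, the mixed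
second difference `B(ω¹,ω'¹) - B(ω¹,ω'⁰) - B(ω⁰,ω'¹) + B(ω⁰,ω'⁰)` is `≤ 0` for all `ω, ω'`
(where `ω¹ = ω[e := true]`, `ω⁰ = ω[e := false]`), then `E_p[B(ω, ω')] ≥ 0` for independent
`ω, ω' ~ P_p` and every edge-probability vector `p ∈ [0,1]^E`. -/
theorem expect2_nonneg_of_flipConcave {p : E → ℝ} (hp : IsProb p)
    {B : Config E → Config E → ℝ} (hdiag : ∀ ω, 0 ≤ B ω ω)
    (hconc : ∀ e ω ω', B (Function.update ω e true) (Function.update ω' e true)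
        - B (Function.update ω e true) (Function.update ω' e false)
        - B (Function.update ω e false) (Function.update ω' e true)
        + B (Function.update ω e false) (Function.update ω' e false) ≤ 0) :
    0 ≤ expect2 p p B := by
  suffices key : ∀ S : Finset E, ∀ q : E → ℝ, IsProb q → (∀ e ∉ S, q e = 0 ∨ q e = 1) →
      0 ≤ expect2 q q B from
    key univ p hp fun e he => absurd (Finset.mem_univ e) he
  intro S
  induction S using Finset.induction_on with
  | empty =>
    intro q _ hdet
    rw [expect2_det fun e => hdet e (Finset.notMem_empty e)]
    exact hdiag _
  | insert e S he ih =>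
    intro q hq hdet
    have hdet' : ∀ x : ℝ, x = 0 ∨ x = 1 →
        ∀ e' ∉ S, Function.update q e x e' = 0 ∨ Function.update q e x e' = 1 := by
      intro x hx e' he'
      by_cases h : e' = e
      · subst h
        simpa using hx
      · rw [Function.update_of_ne h]
        exact hdet e' (by simp [h, he'])
    have h1 := ih (Function.update q e 1) (hq.update e ⟨zero_le_one, le_rfl⟩)
      (hdet' 1 (Or.inr rfl))
    have h0 := ih (Function.update q e 0) (hq.update e ⟨le_rfl, zero_le_one⟩)
      (hdet' 0 (Or.inl rfl))
    have hbr := expect2_bracket_nonneg hq e (hconc e)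
    have hqe := hq e
    rw [expect2_chord q e B]
    have hq01 : 0 ≤ q e * (1 - q e) := mul_nonneg hqe.1 (by linarith [hqe.2])
    nlinarith [mul_nonneg hq01 hbr, mul_nonneg hqe.1 h1, mul_nonneg (sub_nonneg.2 hqe.2) h0]

/-! ### Single-merge concavity: the statistic / quadratic-form formulation -/

/-- **Single-merge concavity**, abstract form.  Let `Φ : Config E → S` be a statistic of the
configuration and `R : S → S → Prop` a relation such that opening any single edge either leaves
`Φ` unchanged or moves it along `R` (`hstep`).  If `A : S → S → ℝ` has nonnegative diagonal and
nonpositive mixed second differences along `R` (`hA`), then `E_p[A(Φ ω, Φ ω')] ≥ 0` for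
independent `ω, ω' ~ P_p`. -/
theorem smc_expect2_xval {S : Type*} {p : E → ℝ} (hp : IsProb p) (Φ : Config E → S)
    (A : S → S → ℝ) (R : S → S → Prop) (hdiag : ∀ s, 0 ≤ A s s)
    (hstep : ∀ e ω, Φ (Function.update ω e false) = Φ (Function.update ω e true) ∨
      R (Φ (Function.update ω e false)) (Φ (Function.update ω e true)))
    (hA : ∀ s t s' t', R s t → R s' t' → A t t' - A t s' - A s t' + A s s' ≤ 0) :
    0 ≤ expect2 p p (fun ω ω' => A (Φ ω) (Φ ω')) := by
  refine expect2_nonneg_of_flipConcave hp (fun ω => hdiag _) ?_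
  intro e ω ω'
  rcases hstep e ω with h | h <;> rcases hstep e ω' with h' | h'
  · rw [h, h']
    linarith
  · rw [h]
    linarith
  · rw [h']
    linarith
  · exact hA _ _ _ _ h h'

/-- The expectation of a function of a statistic `Φ` with values in a finite type, as a sum over
the values weighted by the law of `Φ`. -/
theorem sum_weight_mul_comp {S : Type*} [Fintype S] [DecidableEq S] (p : E → ℝ)
    (Φ : Config E → S) (f : S → ℝ) :
    ∑ ω, weight p ω * f (Φ ω) = ∑ s, prob p (Φ ⁻¹' {s}) * f s := by
  unfold prob
  simp_rw [Finset.sum_mul]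
  rw [Finset.sum_comm]
  refine Finset.sum_congr rfl fun ω _ => ?_
  have key : ∀ s, (Φ ⁻¹' {s}).indicator (weight p) ω * f s =
      if Φ ω = s then weight p ω * f s else 0 := by
    intro s
    by_cases h : Φ ω = s <;> simp [Set.indicator, h]
  simp only [key, Finset.sum_ite_eq, Finset.mem_univ, if_true]

/-- The second moment of a quadratic form in a finite-valued statistic is the quadratic form
evaluated on the law of the statistic. -/
theorem expect2_comp_eq_sum {S : Type*} [Fintype S] [DecidableEq S] (p : E → ℝ)
    (Φ : Config E → S) (A : S → S → ℝ) :
    expect2 p p (fun ω ω' => A (Φ ω) (Φ ω'))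
      = ∑ s, ∑ t, A s t * prob p (Φ ⁻¹' {s}) * prob p (Φ ⁻¹' {t}) := by
  unfold expect2
  have inner : ∀ ω, ∑ ω', weight p ω' * A (Φ ω) (Φ ω')
      = ∑ t, prob p (Φ ⁻¹' {t}) * A (Φ ω) t :=
    fun ω => sum_weight_mul_comp p Φ (fun t => A (Φ ω) t)
  simp_rw [inner]
  rw [sum_weight_mul_comp p Φ (fun s => ∑ t, prob p (Φ ⁻¹' {t}) * A s t)]
  refine Finset.sum_congr rfl fun s _ => ?_
  rw [Finset.mul_sum]
  refine Finset.sum_congr rfl fun t _ => ?_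
  ring

/-- **Single-merge concavity**, law form: under the hypotheses of `smc_expect2` and for a finite
value type `S`, the quadratic form `Σ_{s,t} A s t · P(Φ = s) · P(Φ = t)` is nonnegative. -/
theorem smc_xval {S : Type*} [Fintype S] [DecidableEq S] {p : E → ℝ} (hp : IsProb p)
    (Φ : Config E → S) (A : S → S → ℝ) (R : S → S → Prop) (hdiag : ∀ s, 0 ≤ A s s)
    (hstep : ∀ e ω, Φ (Function.update ω e false) = Φ (Function.update ω e true) ∨
      R (Φ (Function.update ω e false)) (Φ (Function.update ω e true)))
    (hA : ∀ s t s' t', R s t → R s' t' → A t t' - A t s' - A s t' + A s s' ≤ 0) :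
    0 ≤ ∑ s, ∑ t, A s t * prob p (Φ ⁻¹' {s}) * prob p (Φ ⁻¹' {t}) := by
  rw [← expect2_comp_eq_sum]
  exact smc_expect2_xval hp Φ A R hdiag hstep hA

end PercRepro
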